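import Summits.KontsevichZagierPeriods.KontsevichZagierPeriods.Theorems.RootDecompZetaThreeFrontierGZLadderFourPolarP06

/-! # `RootDecompZetaThreeFrontierGZLadderFourPolarP07` — part 7/12 of the mechanical ≤400-line split of `l4_src.lean` (sha256 5cc5a9ee4c47da9a…)
Source: decomp-kz lens-1 g13 Layer4_v1.lean @897236f9 minus the RungFour prelude block (imported from …RungFourPreludeP14); --supports stmt-KontsevichZagierPeriods-27141.
Split by census-1 g10 `gen/splitlean.py`: scopes re-opened with their `open`/`variable`/`set_option` context; mathematics and declaration order unchanged. -/

set_option linter.dupNamespace false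
noncomputable section
set_option linter.dupNamespace false
set_option linter.unusedVariables false
set_option linter.unusedSectionVars false
set_option linter.unusedSimpArgs false
open Set MeasureTheory MvPolynomial
open Literature.NumberTheory.Transcendental
open Summit.KontsevichZagierPeriods.KontsevichZagierPeriods.Theorems.RootDecompZetaThreeFrontierWordMoves
namespace Summit.KontsevichZagierPeriods.KontsevichZagierPeriods.Cruxes.GZNormalFormWThree.GZLadder.OrdFour
open Summit.KontsevichZagierPeriods.KontsevichZagierPeriods.Cruxes.GZNormalFormWThree.GZLadder.RungFour
open Summit.KontsevichZagierPeriods.KontsevichZagierPeriods.Cruxes.GZNormalFormWThree.GZLadder.WlogFour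
open Summit.KontsevichZagierPeriods.KontsevichZagierPeriods.Cruxes.GZNormalFormWThree.GZLadder.MatchFour
open Summit.KontsevichZagierPeriods.KontsevichZagierPeriods.Cruxes.GZNormalFormWThree.GZLadder.GapForm

open Set MeasureTheory MvPolynomial in
open Literature.NumberTheory.Transcendental in
open Summit.KontsevichZagierPeriods.KontsevichZagierPeriods.Theorems.RootDecompZetaThreeFrontierWordMoves in
/-- Auxiliary step `continuous_snoc` (§W1): continuous snoc. [bookkeeping] -/
private theorem continuous_snoc {N : ℕ} (x : Fin N → ℝ) :
    Continuous fun t : ℝ => (Fin.snoc x t : Fin (N + 1) → ℝ) := by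
  refine continuous_pi fun j => ?_
  refine Fin.lastCases ?_ (fun i => ?_) j
  · simpa using continuous_id'
  · simpa using continuous_const

/-- Auxiliary step `fExp4_injective`: f Exp4 injective. [bookkeeping] -/
theorem fExp4_injective : Function.Injective fExp4 := by
  intro e e' h
  obtain ⟨a0, a1, a2, a3⟩ := fExp4_apply e
  obtain ⟨b0, b1, b2, b3⟩ := fExp4_apply e'
  have h0 := DFunLike.congr_fun h 0
  have h1 := DFunLike.congr_fun h 1
  have h2 := DFunLike.congr_fun h 2
  have h3 := DFunLike.congr_fun h 3
  rw [a0, b0] at h0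
  rw [a1, b1] at h1
  rw [a2, b2] at h2
  rw [a3, b3] at h3
  have k2 : e 2 = e' 2 := by omega
  have k1 : e 1 = e' 1 := by omega
  have k0 : e 0 = e' 0 := by omega
  ext j
  fin_cases j
  · exact k0
  · exact k1
  · exact k2
  · exact h2

/-- Jacobian × monomials in the vertex chart -/
theorem jac_aeval_cΨ (Q : MvPolynomial (Fin 4) ℚ) (y : Fin 4 → ℝ) :
    y 3 ^ 3 * y 0 ^ 2 * y 1 * MvPolynomial.aeval (cΨ y) Q = MvPolynomial.aeval y (lift4 vExp4 Q) := by
  rw [aeval_eq_sum_four Q (cΨ y), aeval_lift4, Finset.mul_sum]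
  refine Finset.sum_congr rfl fun e _ => ?_
  obtain ⟨a0, a1, a2, a3⟩ := vExp4_apply e
  rw [a0, a1, a2, a3, cΨ_zero, cΨ_one, cΨ_two, cΨ_three]
  ring

/-- Jacobian × monomials in the edge chart -/
theorem jac_aeval_eΨ (Q : MvPolynomial (Fin 4) ℚ) (y : Fin 4 → ℝ) :
    y 0 ^ 3 * y 3 ^ 2 * y 1 * MvPolynomial.aeval (eΨ y) Q = MvPolynomial.aeval y (lift4 eExp4 Q) := by
  rw [aeval_eq_sum_four Q (eΨ y), aeval_lift4, Finset.mul_sum]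
  refine Finset.sum_congr rfl fun e _ => ?_
  obtain ⟨a0, a1, a2, a3⟩ := eExp4_apply e
  rw [a0, a1, a2, a3, eΨ_zero, eΨ_one, eΨ_two, eΨ_three]
  ring

/-- Jacobian × monomials in the face chart -/
theorem jac_aeval_fΨ (Q : MvPolynomial (Fin 4) ℚ) (y : Fin 4 → ℝ) :
    y 1 ^ 3 * y 0 ^ 2 * y 3 * MvPolynomial.aeval (fΨ y) Q = MvPolynomial.aeval y (lift4 fExp4 Q) := by
  rw [aeval_eq_sum_four Q (fΨ y), aeval_lift4, Finset.mul_sum]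
  refine Finset.sum_congr rfl fun e _ => ?_
  obtain ⟨a0, a1, a2, a3⟩ := fExp4_apply e
  rw [a0, a1, a2, a3, fΨ_zero, fΨ_one, fΨ_two, fΨ_three]
  ring

/-! ### §N5 The three orders forced by integrability: vertex (codim 4), edge (codim 3), face (codim 2) -/

/-- Auxiliary step `cube3_prods` (§N5): cube3 prods. [bookkeeping] -/
theorem cube3_prods {x : Fin 3 → ℝ} (hx : x ∈ Cube3) :
    0 < x 0 ∧ 0 < x 1 ∧ 0 < x 2 ∧ 0 < 1 - x 0 ∧ 0 < 1 - x 1 ∧ 0 < 1 - x 2 ∧ 0 < 1 - x 0 * x 1 ∧ 0 < 1 - x 1 * x 2 ∧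
      0 < 1 - x 0 * x 1 * x 2 ∧ 0 < 1 - x 1 * x 0 ∧ 0 < 1 - x 0 * x 2 := by
  obtain ⟨h0, h01, h1, h11, h2, h21⟩ := hx
  have a : x 0 * x 1 < 1 := mul_lt_one_of_nonneg_of_lt_one_left h0.le h01 h11.le
  have b : x 1 * x 2 < 1 := mul_lt_one_of_nonneg_of_lt_one_left h1.le h11 h21.le
  have c : x 0 * x 1 * x 2 < 1 := mul_lt_one_of_nonneg_of_lt_one_left (mul_pos h0 h1).le a h21.le
  have d : x 1 * x 0 < 1 := mul_lt_one_of_nonneg_of_lt_one_left h1.le h11 h01.le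
  have e : x 0 * x 2 < 1 := mul_lt_one_of_nonneg_of_lt_one_left h0.le h01 h21.le
  exact ⟨h0, h1, h2, by linarith, by linarith, by linarith, by linarith, by linarith, by linarith, by linarith, by linarith⟩

/-- **VERTEX ORDER (codimension 4).**  If `Q/(t₀^{m₀} t₁^{m₁} t₂^{m₂} (t₀-t₂)^{a₀₂} (t₀-t₃)^{a₀₃} (t₁-t₃)^{a₁₃} · D)` is integrable on
`Δ₄`, `D ≠ 0` on `Δ₄` and, in the vertex chart, continuous and non-zero at the face `y₃ = 0` along every section, then every monomial of
`Q` has degree `≥ m₀+m₁+m₂+a₀₂+a₀₃+a₁₃ - 3`. -/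
theorem vertex4_order (Q : MvPolynomial (Fin 4) ℚ) (m₀ m₁ m₂ a₀₂ a₀₃ a₁₃ : ℕ) (D : (Fin 4 → ℝ) → ℝ)
    (hDnz : ∀ t ∈ KZ.openOrderedSimplex 4, D t ≠ 0)
    (hDc : ∀ x ∈ Cube3, ContinuousAt (fun s : ℝ => D (cΨ (Fin.snoc x s))) 0)
    (hD0 : ∀ x ∈ Cube3, D (cΨ (Fin.snoc x (0:ℝ))) ≠ 0)
    (hint : IntegrableOn (fun t => MvPolynomial.aeval t Q /
      (t 0 ^ m₀ * t 1 ^ m₁ * t 2 ^ m₂ * (t 0 - t 2) ^ a₀₂ * (t 0 - t 3) ^ a₀₃ * (t 1 - t 3) ^ a₁₃ * D t))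
      (KZ.openOrderedSimplex 4)) :
    ∀ e ∈ Q.support, m₀ + m₁ + m₂ + a₀₂ + a₀₃ + a₁₃ ≤ e 0 + e 1 + e 2 + e 3 + 3 := by
  have h1 := integrableOn_cchart hint
  have h2 : IntegrableOn (fun y => MvPolynomial.aeval y (lift4 vExp4 Q) /
      (y 3 ^ (m₀ + m₁ + m₂ + a₀₂ + a₀₃ + a₁₃) * (fun y : Fin 4 → ℝ => y 0 ^ (m₁ + m₂ + a₁₃) * y 1 ^ m₂ *
        (1 - y 0 * y 1) ^ a₀₂ * (1 - y 0 * y 1 * y 2) ^ a₀₃ * (1 - y 1 * y 2) ^ a₁₃ * D (cΨ y)) y)) Cube4 := by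
    refine h1.congr_fun (fun y hy => ?_) measurableSet_Cube4
    dsimp only
    rw [← mul_div_assoc, jac_aeval_cΨ]
    congr 1
    rw [cΨ_zero, cΨ_one, cΨ_two, cΨ_three,
      show y 3 - y 3 * y 0 * y 1 = y 3 * (1 - y 0 * y 1) by ring,
      show y 3 - y 3 * y 0 * y 1 * y 2 = y 3 * (1 - y 0 * y 1 * y 2) by ring,
      show y 3 * y 0 - y 3 * y 0 * y 1 * y 2 = y 3 * y 0 * (1 - y 1 * y 2) by ring]
    simp only [mul_pow]
    ring
  have hC : Continuous fun y : Fin 4 → ℝ => y 0 ^ (m₁ + m₂ + a₁₃) * y 1 ^ m₂ *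
      (1 - y 0 * y 1) ^ a₀₂ * (1 - y 0 * y 1 * y 2) ^ a₀₃ * (1 - y 1 * y 2) ^ a₁₃ := by fun_prop
  have hDc' : ∀ x ∈ Cube3, ContinuousAt (fun s : ℝ => (fun y : Fin 4 → ℝ => y 0 ^ (m₁ + m₂ + a₁₃) * y 1 ^ m₂ *
      (1 - y 0 * y 1) ^ a₀₂ * (1 - y 0 * y 1 * y 2) ^ a₀₃ * (1 - y 1 * y 2) ^ a₁₃ * D (cΨ y)) (Fin.snoc x s)) 0 :=
    fun x hx => ((hC.comp (continuous_snoc x)).continuousAt).mul (hDc x hx)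
  have hD0' : ∀ x ∈ Cube3, (fun y : Fin 4 → ℝ => y 0 ^ (m₁ + m₂ + a₁₃) * y 1 ^ m₂ *
      (1 - y 0 * y 1) ^ a₀₂ * (1 - y 0 * y 1 * y 2) ^ a₀₃ * (1 - y 1 * y 2) ^ a₁₃ * D (cΨ y)) (Fin.snoc x (0:ℝ)) ≠ 0 := by
    intro x hx
    obtain ⟨p0, p1, p2, q0, q1, q2, r01, r12, r012, r10, r02⟩ := cube3_prods hx
    refine mul_ne_zero ?_ (hD0 x hx)
    simp only [snoc3_zero, snoc3_one, snoc3_two]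
    positivity
  intro e he
  have key := cube_face4 _ hDc' hD0' _ (lift4 vExp4 Q) h2 _ (mem_support_lift4 vExp4_injective Q he)
  rwa [(vExp4_apply e).2.2.2] at key

/-- **EDGE ORDER (codimension 3, cluster `t₁ = t₂ = t₃ = 0`).** -/
theorem edge4_order (Q : MvPolynomial (Fin 4) ℚ) (m₁ m₂ a₁₃ : ℕ) (D : (Fin 4 → ℝ) → ℝ)
    (hDnz : ∀ t ∈ KZ.openOrderedSimplex 4, D t ≠ 0)
    (hDc : ∀ x ∈ Cube3, ContinuousAt (fun s : ℝ => D (eΨ (Fin.snoc x s))) 0)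
    (hD0 : ∀ x ∈ Cube3, D (eΨ (Fin.snoc x (0:ℝ))) ≠ 0)
    (hint : IntegrableOn (fun t => MvPolynomial.aeval t Q / (t 1 ^ m₁ * t 2 ^ m₂ * (t 1 - t 3) ^ a₁₃ * D t))
      (KZ.openOrderedSimplex 4)) :
    ∀ e ∈ Q.support, m₁ + m₂ + a₁₃ ≤ e 1 + e 2 + e 3 + 2 := by
  have h1 := integrableOn_echart hint
  have h2 : IntegrableOn (fun y => MvPolynomial.aeval y (lift4 eExp4 Q) /
      (y 3 ^ (m₁ + m₂ + a₁₃) * (fun y : Fin 4 → ℝ => y 0 ^ (m₁ + m₂ + a₁₃) * y 1 ^ m₂ * (1 - y 1 * y 2) ^ a₁₃ *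
        D (eΨ y)) y)) Cube4 := by
    refine h1.congr_fun (fun y hy => ?_) measurableSet_Cube4
    dsimp only
    rw [← mul_div_assoc, jac_aeval_eΨ]
    congr 1
    rw [eΨ_one, eΨ_two, eΨ_three,
      show y 0 * y 3 - y 0 * y 3 * y 1 * y 2 = y 0 * y 3 * (1 - y 1 * y 2) by ring]
    simp only [mul_pow]
    ring
  have hC : Continuous fun y : Fin 4 → ℝ => y 0 ^ (m₁ + m₂ + a₁₃) * y 1 ^ m₂ * (1 - y 1 * y 2) ^ a₁₃ := by fun_prop
  have hDc' : ∀ x ∈ Cube3, ContinuousAt (fun s : ℝ => (fun y : Fin 4 → ℝ => y 0 ^ (m₁ + m₂ + a₁₃) * y 1 ^ m₂ *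
      (1 - y 1 * y 2) ^ a₁₃ * D (eΨ y)) (Fin.snoc x s)) 0 :=
    fun x hx => ((hC.comp (continuous_snoc x)).continuousAt).mul (hDc x hx)
  have hD0' : ∀ x ∈ Cube3, (fun y : Fin 4 → ℝ => y 0 ^ (m₁ + m₂ + a₁₃) * y 1 ^ m₂ * (1 - y 1 * y 2) ^ a₁₃ *
      D (eΨ y)) (Fin.snoc x (0:ℝ)) ≠ 0 := by
    intro x hx
    obtain ⟨p0, p1, p2, q0, q1, q2, r01, r12, r012, r10, r02⟩ := cube3_prods hx
    refine mul_ne_zero ?_ (hD0 x hx)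
    simp only [snoc3_zero, snoc3_one, snoc3_two]
    positivity
  intro e he
  have key := cube_face4 _ hDc' hD0' _ (lift4 eExp4 Q) h2 _ (mem_support_lift4 eExp4_injective Q he)
  rwa [(eExp4_apply e).2.2.2] at key

/-- **FACE ORDER (codimension 2, cluster `t₂ = t₃ = 0`).** -/
theorem face4_order (Q : MvPolynomial (Fin 4) ℚ) (m : ℕ) (D : (Fin 4 → ℝ) → ℝ)
    (hDnz : ∀ t ∈ KZ.openOrderedSimplex 4, D t ≠ 0)
    (hDc : ∀ x ∈ Cube3, ContinuousAt (fun s : ℝ => D (fΨ (Fin.snoc x s))) 0)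
    (hD0 : ∀ x ∈ Cube3, D (fΨ (Fin.snoc x (0:ℝ))) ≠ 0)
    (hint : IntegrableOn (fun t => MvPolynomial.aeval t Q / (t 2 ^ m * D t)) (KZ.openOrderedSimplex 4)) :
    ∀ e ∈ Q.support, m ≤ e 2 + e 3 + 1 := by
  have h1 := integrableOn_fchart hint
  have h2 : IntegrableOn (fun y => MvPolynomial.aeval y (lift4 fExp4 Q) /
      (y 3 ^ m * (fun y : Fin 4 → ℝ => y 1 ^ m * y 0 ^ m * D (fΨ y)) y)) Cube4 := by
    refine h1.congr_fun (fun y hy => ?_) measurableSet_Cube4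
    dsimp only
    rw [← mul_div_assoc, jac_aeval_fΨ]
    congr 1
    rw [fΨ_two]
    simp only [mul_pow]
    ring
  have hC : Continuous fun y : Fin 4 → ℝ => y 1 ^ m * y 0 ^ m := by fun_prop
  have hDc' : ∀ x ∈ Cube3, ContinuousAt (fun s : ℝ => (fun y : Fin 4 → ℝ => y 1 ^ m * y 0 ^ m * D (fΨ y))
      (Fin.snoc x s)) 0 :=
    fun x hx => ((hC.comp (continuous_snoc x)).continuousAt).mul (hDc x hx)
  have hD0' : ∀ x ∈ Cube3, (fun y : Fin 4 → ℝ => y 1 ^ m * y 0 ^ m * D (fΨ y)) (Fin.snoc x (0:ℝ)) ≠ 0 := by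
    intro x hx
    obtain ⟨p0, p1, p2, q0, q1, q2, r01, r12, r012, r10, r02⟩ := cube3_prods hx
    refine mul_ne_zero ?_ (hD0 x hx)
    simp only [snoc3_zero, snoc3_one]
    positivity
  intro e he
  have key := cube_face4 _ hDc' hD0' _ (lift4 fExp4 Q) h2 _ (mem_support_lift4 fExp4_injective Q he)
  rwa [(fExp4_apply e).2.2.2] at key

/-! ### §N6 The nine orders of an integrable reduced datum; `OrdersFour` -/

/-- the reduced integrand of `IsReducedFour` (token-identical denominator) -/
def rf4 (p : MvPolynomial (Fin 4) ℚ) (β₀ β₁ β₂ γ₁ γ₂ γ₃ α₀₂ α₀₃ α₁₃ : ℕ) (t : Fin 4 → ℝ) : ℝ :=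
  MvPolynomial.aeval t p /
    (t 0 ^ β₀ * t 1 ^ β₁ * t 2 ^ β₂ * (1 - t 1) ^ γ₁ * (1 - t 2) ^ γ₂ * (1 - t 3) ^ γ₃ * (t 0 - t 2) ^ α₀₂ * (t 0 - t 3) ^ α₀₃ *
      (t 1 - t 3) ^ α₁₃)

/-- (1) the vertex `(0,0,0,0)` -/
theorem rf4_order1 (p : MvPolynomial (Fin 4) ℚ) (β₀ β₁ β₂ γ₁ γ₂ γ₃ α₀₂ α₀₃ α₁₃ : ℕ)
    (hint : IntegrableOn (rf4 p β₀ β₁ β₂ γ₁ γ₂ γ₃ α₀₂ α₀₃ α₁₃) (KZ.openOrderedSimplex 4)) :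
    ∀ e ∈ p.support, β₀ + β₁ + β₂ + α₀₂ + α₀₃ + α₁₃ ≤ e 0 + e 1 + e 2 + e 3 + 3 := by
  have hDcont : Continuous fun t : Fin 4 → ℝ => (1 - t 1) ^ γ₁ * (1 - t 2) ^ γ₂ * (1 - t 3) ^ γ₃ := by fun_prop
  refine vertex4_order p β₀ β₁ β₂ α₀₂ α₀₃ α₁₃ (fun t => (1 - t 1) ^ γ₁ * (1 - t 2) ^ γ₂ * (1 - t 3) ^ γ₃)
    (fun t ht => ?_) (fun x _ => ((hDcont.comp continuous_cΨ).comp (continuous_snoc x)).continuousAt) (fun x hx => ?_)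
    (hint.congr_fun (fun t _ => by simp only [rf4]; congr 1; ring) (measurableSet_simplex 4))
  · obtain ⟨g0, g1, g2, g3, g4, g5, g6, g7, g8, g9, g10, g11, g12, g13⟩ := gz4_denoms_pos ht
    positivity
  · obtain ⟨p0, p1, p2, q0, q1, q2, r01, r12, r012, r10, r02⟩ := cube3_prods hx
    simp [snoc3_zero, snoc3_one, snoc3_two, snoc3_three]

/-- (2) the edge `t₁ = t₂ = t₃ = 0` -/
theorem rf4_order2 (p : MvPolynomial (Fin 4) ℚ) (β₀ β₁ β₂ γ₁ γ₂ γ₃ α₀₂ α₀₃ α₁₃ : ℕ)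
    (hint : IntegrableOn (rf4 p β₀ β₁ β₂ γ₁ γ₂ γ₃ α₀₂ α₀₃ α₁₃) (KZ.openOrderedSimplex 4)) :
    ∀ e ∈ p.support, β₁ + β₂ + α₁₃ ≤ e 1 + e 2 + e 3 + 2 := by
  have hDcont : Continuous fun t : Fin 4 → ℝ =>
      t 0 ^ β₀ * (1 - t 1) ^ γ₁ * (1 - t 2) ^ γ₂ * (1 - t 3) ^ γ₃ * (t 0 - t 2) ^ α₀₂ * (t 0 - t 3) ^ α₀₃ := by fun_prop
  refine edge4_order p β₁ β₂ α₁₃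
    (fun t => t 0 ^ β₀ * (1 - t 1) ^ γ₁ * (1 - t 2) ^ γ₂ * (1 - t 3) ^ γ₃ * (t 0 - t 2) ^ α₀₂ * (t 0 - t 3) ^ α₀₃)
    (fun t ht => ?_) (fun x _ => ((hDcont.comp continuous_eΨ).comp (continuous_snoc x)).continuousAt) (fun x hx => ?_)
    (hint.congr_fun (fun t _ => by simp only [rf4]; congr 1; ring) (measurableSet_simplex 4))
  · obtain ⟨g0, g1, g2, g3, g4, g5, g6, g7, g8, g9, g10, g11, g12, g13⟩ := gz4_denoms_pos ht
    positivity
  · obtain ⟨p0, p1, p2, q0, q1, q2, r01, r12, r012, r10, r02⟩ := cube3_prods hx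
    simp only [eΨ_zero, eΨ_one, eΨ_two, eΨ_three, snoc3_zero, snoc3_one, snoc3_two, snoc3_three, mul_zero, zero_mul,
      sub_zero, one_pow, mul_one]
    positivity

/-- (3) the face `t₂ = t₃ = 0` -/
theorem rf4_order3 (p : MvPolynomial (Fin 4) ℚ) (β₀ β₁ β₂ γ₁ γ₂ γ₃ α₀₂ α₀₃ α₁₃ : ℕ)
    (hint : IntegrableOn (rf4 p β₀ β₁ β₂ γ₁ γ₂ γ₃ α₀₂ α₀₃ α₁₃) (KZ.openOrderedSimplex 4)) :
    ∀ e ∈ p.support, β₂ ≤ e 2 + e 3 + 1 := by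
  have hDcont : Continuous fun t : Fin 4 → ℝ => t 0 ^ β₀ * t 1 ^ β₁ * (1 - t 1) ^ γ₁ * (1 - t 2) ^ γ₂ * (1 - t 3) ^ γ₃ *
      (t 0 - t 2) ^ α₀₂ * (t 0 - t 3) ^ α₀₃ * (t 1 - t 3) ^ α₁₃ := by fun_prop
  refine face4_order p β₂
    (fun t => t 0 ^ β₀ * t 1 ^ β₁ * (1 - t 1) ^ γ₁ * (1 - t 2) ^ γ₂ * (1 - t 3) ^ γ₃ * (t 0 - t 2) ^ α₀₂ * (t 0 - t 3) ^ α₀₃ *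
      (t 1 - t 3) ^ α₁₃)
    (fun t ht => ?_) (fun x _ => ((hDcont.comp continuous_fΨ).comp (continuous_snoc x)).continuousAt) (fun x hx => ?_)
    (hint.congr_fun (fun t _ => by simp only [rf4]; congr 1; ring) (measurableSet_simplex 4))
  · obtain ⟨g0, g1, g2, g3, g4, g5, g6, g7, g8, g9, g10, g11, g12, g13⟩ := gz4_denoms_pos ht
    positivity
  · obtain ⟨p0, p1, p2, q0, q1, q2, r01, r12, r012, r10, r02⟩ := cube3_prods hx
    simp only [fΨ_zero, fΨ_one, fΨ_two, fΨ_three, snoc3_zero, snoc3_one, snoc3_two, snoc3_three, mul_zero, zero_mul,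
      sub_zero, one_pow, mul_one]
    positivity

/-- the duality `σ₄` on reduced data -/
theorem rf4_dual (p : MvPolynomial (Fin 4) ℚ) (β₀ β₁ β₂ γ₁ γ₂ γ₃ α₀₂ α₀₃ α₁₃ : ℕ)
    (hint : IntegrableOn (rf4 p β₀ β₁ β₂ γ₁ γ₂ γ₃ α₀₂ α₀₃ α₁₃) (KZ.openOrderedSimplex 4)) :
    IntegrableOn (rf4 (du4P p) γ₃ γ₂ γ₁ β₂ β₁ β₀ α₁₃ α₀₃ α₀₂) (KZ.openOrderedSimplex 4) := by
  refine (integrableOn_comp_du4 hint).congr_fun (fun z _ => ?_) (measurableSet_simplex 4)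
  show rf4 p β₀ β₁ β₂ γ₁ γ₂ γ₃ α₀₂ α₀₃ α₁₃ (du4 z) = rf4 (du4P p) γ₃ γ₂ γ₁ β₂ β₁ β₀ α₁₃ α₀₃ α₀₂ z
  simp only [rf4, aeval_du4P, du4_zero, du4_one, du4_two, du4_three, sub_sub_cancel, sub_sub_sub_cancel_left]
  congr 1
  ring

/-- (4), (5), (6): the clusters at `1`, read on `du4P p` -/
theorem rf4_orders_far (p : MvPolynomial (Fin 4) ℚ) (β₀ β₁ β₂ γ₁ γ₂ γ₃ α₀₂ α₀₃ α₁₃ : ℕ)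
    (hint : IntegrableOn (rf4 p β₀ β₁ β₂ γ₁ γ₂ γ₃ α₀₂ α₀₃ α₁₃) (KZ.openOrderedSimplex 4)) :
    (∀ e ∈ (du4P p).support, γ₁ + γ₂ + γ₃ + α₀₂ + α₀₃ + α₁₃ ≤ e 0 + e 1 + e 2 + e 3 + 3) ∧
    (∀ e ∈ (du4P p).support, γ₁ + γ₂ + α₀₂ ≤ e 1 + e 2 + e 3 + 2) ∧
    (∀ e ∈ (du4P p).support, γ₁ ≤ e 2 + e 3 + 1) := by
  have h := rf4_dual p β₀ β₁ β₂ γ₁ γ₂ γ₃ α₀₂ α₀₃ α₁₃ hint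
  refine ⟨fun e he => ?_, fun e he => ?_, rf4_order3 _ _ _ _ _ _ _ _ _ _ h⟩
  · have := rf4_order1 _ _ _ _ _ _ _ _ _ _ h e he
    omega
  · have := rf4_order2 _ _ _ _ _ _ _ _ _ _ h e he
    omega

/-- (7), (8): the clusters `t₀ = t₁ = t₂` and `t₀ = t₁ = t₂ = t₃`, read on `s03P p` in `u = (t₀, t₀-t₃, t₀-t₂, t₀-t₁)` -/
theorem rf4_orders_s03 (p : MvPolynomial (Fin 4) ℚ) (β₀ β₁ β₂ γ₁ γ₂ γ₃ α₀₂ α₀₃ α₁₃ : ℕ)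
    (hint : IntegrableOn (rf4 p β₀ β₁ β₂ γ₁ γ₂ γ₃ α₀₂ α₀₃ α₁₃) (KZ.openOrderedSimplex 4)) :
    (∀ e ∈ (s03P p).support, α₀₂ ≤ e 2 + e 3 + 1) ∧
    (∀ e ∈ (s03P p).support, α₀₂ + α₀₃ + α₁₃ ≤ e 1 + e 2 + e 3 + 2) := by
  have h := integrableOn_comp_s03 hint
  have hDcont : Continuous fun u : Fin 4 → ℝ => u 0 ^ β₀ * (u 0 - u 3) ^ β₁ * (u 0 - u 2) ^ β₂ * (1 - (u 0 - u 3)) ^ γ₁ *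
      (1 - (u 0 - u 2)) ^ γ₂ * (1 - (u 0 - u 1)) ^ γ₃ := by fun_prop
  have hDcont' : Continuous fun u : Fin 4 → ℝ => u 0 ^ β₀ * (u 0 - u 3) ^ β₁ * (u 0 - u 2) ^ β₂ * (1 - (u 0 - u 3)) ^ γ₁ *
      (1 - (u 0 - u 2)) ^ γ₂ * (1 - (u 0 - u 1)) ^ γ₃ * u 1 ^ α₀₃ * (u 1 - u 3) ^ α₁₃ := by fun_prop
  constructor
  · refine face4_order (s03P p) α₀₂
      (fun u => u 0 ^ β₀ * (u 0 - u 3) ^ β₁ * (u 0 - u 2) ^ β₂ * (1 - (u 0 - u 3)) ^ γ₁ * (1 - (u 0 - u 2)) ^ γ₂ *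
        (1 - (u 0 - u 1)) ^ γ₃ * u 1 ^ α₀₃ * (u 1 - u 3) ^ α₁₃)
      (fun u hu => ?_) (fun x _ => ((hDcont'.comp continuous_fΨ).comp (continuous_snoc x)).continuousAt) (fun x hx => ?_)
      (h.congr_fun (fun u _ => ?_) (measurableSet_simplex 4))
    · obtain ⟨g0, g1, g2, g3, g4, g5, g6, g7, g8, g9, g10, g11, g12, g13⟩ := gz4_denoms_pos hu
      have : (0:ℝ) < 1 - (u 0 - u 3) := by linarith
      have : (0:ℝ) < 1 - (u 0 - u 2) := by linarith
      have : (0:ℝ) < 1 - (u 0 - u 1) := by linarith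
      positivity
    · obtain ⟨p0, p1, p2, q0, q1, q2, r01, r12, r012, r10, r02⟩ := cube3_prods hx
      simp only [fΨ_zero, fΨ_one, fΨ_two, fΨ_three, snoc3_zero, snoc3_one, snoc3_two, snoc3_three, mul_zero, zero_mul,
        sub_zero, one_pow, mul_one]
      have : (0:ℝ) < 1 - (x 1 - x 1 * x 0) := by nlinarith [mul_pos p1 p0]
      positivity
    · show rf4 p β₀ β₁ β₂ γ₁ γ₂ γ₃ α₀₂ α₀₃ α₁₃ (s03 u) = _
      simp only [rf4, aeval_s03P, s03_zero, s03_one, s03_two, s03_three, sub_sub_cancel, sub_sub_sub_cancel_left]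
      congr 1
      ring
  · intro e he
    have key := edge4_order (s03P p) α₀₃ α₀₂ α₁₃
      (fun u => u 0 ^ β₀ * (u 0 - u 3) ^ β₁ * (u 0 - u 2) ^ β₂ * (1 - (u 0 - u 3)) ^ γ₁ * (1 - (u 0 - u 2)) ^ γ₂ *
        (1 - (u 0 - u 1)) ^ γ₃)
      (fun u hu => ?_) (fun x _ => ((hDcont.comp continuous_eΨ).comp (continuous_snoc x)).continuousAt) (fun x hx => ?_)
      (h.congr_fun (fun u _ => ?_) (measurableSet_simplex 4)) e he
    · omega
    · obtain ⟨g0, g1, g2, g3, g4, g5, g6, g7, g8, g9, g10, g11, g12, g13⟩ := gz4_denoms_pos hu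
      have : (0:ℝ) < 1 - (u 0 - u 3) := by linarith
      have : (0:ℝ) < 1 - (u 0 - u 2) := by linarith
      have : (0:ℝ) < 1 - (u 0 - u 1) := by linarith
      positivity
    · obtain ⟨p0, p1, p2, q0, q1, q2, r01, r12, r012, r10, r02⟩ := cube3_prods hx
      simp only [eΨ_zero, eΨ_one, eΨ_two, eΨ_three, snoc3_zero, snoc3_one, snoc3_two, snoc3_three, mul_zero, zero_mul,
        sub_zero, one_pow, mul_one]
      positivity
    · show rf4 p β₀ β₁ β₂ γ₁ γ₂ γ₃ α₀₂ α₀₃ α₁₃ (s03 u) = _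
      simp only [rf4, aeval_s03P, s03_zero, s03_one, s03_two, s03_three, sub_sub_cancel, sub_sub_sub_cancel_left]
      congr 1
      ring

/-- (9): the cluster `t₁ = t₂ = t₃`, read on `s13P p` in `u = (t₀, t₁, t₁-t₃, t₁-t₂)` -/
theorem rf4_order_s13 (p : MvPolynomial (Fin 4) ℚ) (β₀ β₁ β₂ γ₁ γ₂ γ₃ α₀₂ α₀₃ α₁₃ : ℕ)
    (hint : IntegrableOn (rf4 p β₀ β₁ β₂ γ₁ γ₂ γ₃ α₀₂ α₀₃ α₁₃) (KZ.openOrderedSimplex 4)) :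
    ∀ e ∈ (s13P p).support, α₁₃ ≤ e 2 + e 3 + 1 := by
  have h := integrableOn_comp_s13 hint
  have hDcont : Continuous fun u : Fin 4 → ℝ => u 0 ^ β₀ * u 1 ^ β₁ * (u 1 - u 3) ^ β₂ * (1 - u 1) ^ γ₁ *
      (1 - (u 1 - u 3)) ^ γ₂ * (1 - (u 1 - u 2)) ^ γ₃ * (u 0 - (u 1 - u 3)) ^ α₀₂ * (u 0 - (u 1 - u 2)) ^ α₀₃ := by
    fun_prop
  refine face4_order (s13P p) α₁₃
    (fun u => u 0 ^ β₀ * u 1 ^ β₁ * (u 1 - u 3) ^ β₂ * (1 - u 1) ^ γ₁ * (1 - (u 1 - u 3)) ^ γ₂ * (1 - (u 1 - u 2)) ^ γ₃ *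
      (u 0 - (u 1 - u 3)) ^ α₀₂ * (u 0 - (u 1 - u 2)) ^ α₀₃)
    (fun u hu => ?_) (fun x _ => ((hDcont.comp continuous_fΨ).comp (continuous_snoc x)).continuousAt) (fun x hx => ?_)
    (h.congr_fun (fun u _ => ?_) (measurableSet_simplex 4))
  · obtain ⟨g0, g1, g2, g3, g4, g5, g6, g7, g8, g9, g10, g11, g12, g13⟩ := gz4_denoms_pos hu
    have : (0:ℝ) < 1 - (u 1 - u 3) := by linarith
    have : (0:ℝ) < 1 - (u 1 - u 2) := by linarith
    have : (0:ℝ) < u 0 - (u 1 - u 3) := by linarith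
    have : (0:ℝ) < u 0 - (u 1 - u 2) := by linarith
    positivity
  · obtain ⟨p0, p1, p2, q0, q1, q2, r01, r12, r012, r10, r02⟩ := cube3_prods hx
    simp only [fΨ_zero, fΨ_one, fΨ_two, fΨ_three, snoc3_zero, snoc3_one, snoc3_two, snoc3_three, mul_zero, zero_mul,
      sub_zero, one_pow, mul_one]
    have : (0:ℝ) < x 1 - x 1 * x 0 := by nlinarith [mul_pos p1 q0]
    positivity
  · show rf4 p β₀ β₁ β₂ γ₁ γ₂ γ₃ α₀₂ α₀₃ α₁₃ (s13 u) = _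
    simp only [rf4, aeval_s13P, s13_zero, s13_one, s13_two, s13_three, sub_sub_cancel, sub_sub_sub_cancel_left]
    congr 1
    ring

end Summit.KontsevichZagierPeriods.KontsevichZagierPeriods.Cruxes.GZNormalFormWThree.GZLadder.OrdFour
end
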